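import Summits.BirchSwinnertonDyer.Rank1Residual.Supersingular.KobayashiMainConjecture
import Summits.BirchSwinnertonDyer.BirchSwinnertonDyer.Theorems.ByReductionTypeAtTwoMultTransportData
import Summits.BirchSwinnertonDyer.Rank1Residual.X1.LambdaSqueezeAlgebra
import Literature.NumberTheory.EllipticCurves.BDKim2009.SignedSelmerCongruentLambdaInvariant
import HarnessLib

/-!
# Crux `SignedTransportAtTwo` (stmt-BirchSwinnertonDyer-20306, route `ThetaPartnerAtTwo`): the CLASS-LEVEL BRIDGE
# «signed transport at `p = 2` from a CM partner» ⇐ three displayed `p = 2` research binders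
# (lead prover bsd-wall-tp2-p1 g0; `--supports stmt-BirchSwinnertonDyer-20306 --as helper`; closes nothing)

HONEST FRAMING. THEOREMS ONLY; every research input is an explicit hypothesis spelled inline; nothing about
any curve is asserted; BSD is not proved by any of this. This is the `p = 2`, CLASS-LEVEL twin of the tree's
odd-`p` PER-PAIR road `SmallImageCongruenceRoad.kobayashiMainConjecture_of_lambdaTransfer_of_mu_at_conductor`
(`Theorems/SignedLowerHalvesKobayashiMainConjectureSmallImageLambdaTransferCM.lean`, p473173), written for
the REPAIRED form of the crux K1 of route ThetaPartnerAtTwo (the filed K1, stmt-20306, cannot use its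
hypothesis `KobayashiMainConjecture A 2 1`: no newform / period ratio / Pollack pair of the partner `A` is in
scope — lead prover's verdict «misstated», evidence K1-VERDICT-misstated.md on the item).

## The bridge `kobayashiMainConjecture_two_of_signedTransportBinders`

For `(W, A)` on the theta habitat (`W` non-CM, `r_an(W) = 0`, both good supersingular at `2` with `a₂ = 0`,
`W[2] ≅ A[2]`), GIVEN — as displayed hypotheses, the `p = 2` twins of statements the tree holds at odd `p`:
* `hmu2`  = B. D. Kim 2009 Cor. 2.13 `μ`-half READ AT `2` (body of `BDKim2009.cor213_signedMu_eq_zero_iff_of_torsionIso`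
  with `p = 2`, direction partner → curve);
* `hlam2`  = Cor. 2.13 `λ`-half ∘ Cor. 2.5 ∘ Prop. 2.6 READ AT `2` (body of
  `BDKim2009.cor213_signedLambda_add_sum_delta_eq_of_torsionIso` with `p = 2`);
* `hV2`  = the ANALYTIC congruence at `2` of the Néron-normalised signed `2`-adic `L`-functions along
  `W[2] ≅ A[2]` on INTEGRAL elements (`ι G = 2^m ϖ ι L♭_W`, `ι G_A = 2^{m'} ϖ_A ι L♭_A`): equal `μ` up to the
  displayed powers of `2` and `λ(G) + Σ_{S₀} δ_W = λ(G_A) + Σ_{S₀} δ_A` — Vatsal 1999 / Emerton–Pollack–Weston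
  2006 SHAPE; NO refereed source for signed `L`-functions at any `p` (p473173's literature note: Pollack–Weston
  2011 cite [GIP] "in preparation"; Corpuz–Lei arXiv:2508.09733 (2025) is a preprint), let alone at `2`;
and the REPAIRED K1 binders — the partner's signed duals f.g. torsion with `μ = 0` (K2′), `KobayashiMainConjecture
A 2 1`, the partner's newform `f_A`, period ratio `ϖ_A` and a Pollack pair at `2` (NEW), the curve's signed
duals f.g. torsion (Kobayashi 1.2 at `2`, K4c′), Kato's divisibility up to `2^m` (K3 verbatim) — conclude
`KobayashiMainConjecture W 2 1`. PROVED here: the admissible place set `S₀` (§1), the bookkeeping (§2) on the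
tree's element-level `μ/λ` (`X1.MuLambda`: `mu_mul`, `lam_mul`, generator lemmas `MuPart.mu_generator_eq_muInvariant`,
`ParitySqueeze.lam_generator_eq_lambdaInvariant`), and the composition (§3).

References: [BDKim2009] Cor. 2.13, Cor. 2.5, Prop. 2.6; [Kobayashi2003] Thm. 1.2, Conj. (p. 2); [GreenbergVatsal2000]
Prop. (2.4), p. 4; [EmertonPollackWeston2006] Thm. 1; [Vatsal1999]; [Washington1997] §7.1, §13.2.
-/

set_option autoImplicit false
-- D-0017: single-problem summit, so `Summit.BirchSwinnertonDyer.BirchSwinnertonDyer.…` repeats a namespace BY DESIGN.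
set_option linter.dupNamespace false

noncomputable section

open scoped Classical MatrixGroups ModularForm BigOperators

open CongruenceSubgroup WeierstrassCurve NumberField IsDedekindDomain Rat.HeightOneSpectrum
  Literature Literature.NumberTheory.EllipticCurves
  Literature.NumberTheory.EllipticCurves.ModularForms
  Literature.NumberTheory.EllipticCurves.Rank1Residual
  Literature.NumberTheory.EllipticCurves.Kobayashi2003 ZpExtension
  Literature.NumberTheory.EllipticCurves.GreenbergVatsal2000
  Summit.BirchSwinnertonDyer.Rank1Residual.X1.MuLambda
  Summit.BirchSwinnertonDyer.Rank1Residual.Supersingular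

namespace Summit.BirchSwinnertonDyer.BirchSwinnertonDyer.Theorems.SignedTransportAtTwo

/-! ## §1. An admissible place set `S₀`: the odd bad places of `W` and `A` -/

/-- Good reduction at the place above `2` from good reduction at the prime `2`. [folklore] -/
theorem hasGoodReductionAt_of_two_mem (W : WeierstrassCurve ℚ) [W.IsElliptic]
    (hW : W.HasGoodReductionAtPrime 2) (v : HeightOneSpectrum (𝓞 ℚ))
    (hv : ((2 : ℕ) : 𝓞 ℚ) ∈ v.asIdeal) : W.HasGoodReductionAt v := by
  have hp : (primesEquiv v : ℕ) = 2 := primesEquiv_eq_of_natCast_mem v Nat.prime_two hv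
  have key : ∀ q : Nat.Primes, (q : ℕ) = 2 → (haveI := Fact.mk q.2; W.HasGoodReductionAtPrime q) := by
    rintro ⟨q, hq⟩ h
    simp only at h
    subst h
    exact hW
  exact (hasGoodReductionAtPrime_iff_hasGoodReductionAt_ringOfIntegers v W).mp (key _ hp)

/-- An admissible `S₀` for B. D. Kim's Cor. 2.13 at `p = 2`: the places above the odd prime factors of
`N_W · N_A`. [folklore] -/
theorem exists_admissiblePlaces (W A : WeierstrassCurve ℚ) [W.IsElliptic] [A.IsElliptic]
    (hW : W.HasGoodReductionAtPrime 2) (hA : A.HasGoodReductionAtPrime 2) :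
    ∃ S₀ : Finset (HeightOneSpectrum (𝓞 ℚ)), (∀ v ∈ S₀, ((2 : ℕ) : 𝓞 ℚ) ∉ v.asIdeal) ∧
      (∀ v : HeightOneSpectrum (𝓞 ℚ), ¬ W.HasGoodReductionAt v → v ∈ S₀) ∧
      (∀ v : HeightOneSpectrum (𝓞 ℚ), ¬ A.HasGoodReductionAt v → v ∈ S₀) := by
  classical
  set S : Finset ℕ := (W.conductorNorm ℤ).primeFactors ∪ (A.conductorNorm ℤ).primeFactors with hS_def
  have hS : ∀ ℓ ∈ S, ℓ.Prime := by
    intro ℓ hℓ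
    rcases Finset.mem_union.mp hℓ with h | h <;> exact Nat.prime_of_mem_primeFactors h
  obtain ⟨S₀, hS₀⟩ := Theorems.MultTransportAtTwo.exists_oddPlaces S hS
  refine ⟨S₀, Theorems.MultTransportAtTwo.two_notMem_of_mem_oddPlaces S₀ hS₀, fun v hv ↦ ?_, fun v hv ↦ ?_⟩
  · by_contra hvS
    by_cases h2 : ((2 : ℕ) : 𝓞 ℚ) ∈ v.asIdeal
    · exact hv (hasGoodReductionAt_of_two_mem W hW v h2)
    · exact hv (Theorems.MultTransportAtTwo.hasGoodReductionAt_of_notMem_oddPlaces S₀ hS₀ W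
        Finset.subset_union_left v hvS h2)
  · by_contra hvS
    by_cases h2 : ((2 : ℕ) : 𝓞 ℚ) ∈ v.asIdeal
    · exact hv (hasGoodReductionAt_of_two_mem A hA v h2)
    · exact hv (Theorems.MultTransportAtTwo.hasGoodReductionAt_of_notMem_oddPlaces S₀ hS₀ A
        Finset.subset_union_right v hvS h2)

/-! ## §2. Bookkeeping lemmas -/


/-- `C(ϖ) · ι(L^+) ≠ 0` for the newform `f` of ANY `W`, `ϖ · Ω_W = Ω⁺_f`, and a Pollack pair (the proof of
the landed `Theorems.stub_nonvanishingTwo`, which carries unused habitat binders). [folklore] -/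
theorem C_mul_iota_ne_zero {W : WeierstrassCurve ℚ} [W.IsElliptic] [W.IsGloballyMinimal]
    [NeZero (W.conductorNorm ℤ)] {f : CuspForm (Gamma0 (W.conductorNorm ℤ)) 2} (hf : IsNewformOf W f)
    {ϖ : ℚ} (hϖ : (ϖ : ℝ) * W.realPeriodRat = plusPeriod f) {Lplus Lminus : IwasawaAlgebra 2}
    (hPP : IsPollackPair f 2 Lplus Lminus) :
    PowerSeries.C (ϖ : ℚ_[2]) * iwasawaToPowerSeries 2 (kobayashiL 1 Lplus Lminus) ≠ 0 := by
  have hpos : 0 < plusPeriod f := IsNewform0.plusPeriod_pos_holds hf.1 hf.coeffField_eq_bot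
  have hϖ0 : ϖ ≠ 0 := by
    rintro rfl
    rw [Rat.cast_zero, zero_mul] at hϖ
    exact absurd hϖ hpos.ne
  have hL : kobayashiL (1 : ℤˣ) Lplus Lminus = Lminus := by
    unfold kobayashiL; rw [if_pos rfl]
  have hLne : iwasawaToPowerSeries 2 (kobayashiL (1 : ℤˣ) Lplus Lminus) ≠ 0 := by
    rw [hL]
    intro h0
    exact hPP.2.1 (iwasawaToPowerSeries_injective 2 (by rw [h0, map_zero]))
  exact mul_ne_zero ((map_ne_zero_iff _ PowerSeries.C_injective).mpr (by exact_mod_cast hϖ0)) hLne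

/-- `C(2^m ϖ) · ι L ≠ 0` from `C(ϖ) · ι L ≠ 0`. [folklore] -/
theorem C_pow_mul_ne_zero {ϖ : ℚ} {L : IwasawaAlgebra 2} (m : ℕ)
    (h : PowerSeries.C (ϖ : ℚ_[2]) * iwasawaToPowerSeries 2 L ≠ 0) :
    PowerSeries.C ((2 : ℚ_[2]) ^ m * (ϖ : ℚ_[2])) * iwasawaToPowerSeries 2 L ≠ 0 := by
  rw [map_mul, mul_assoc]
  exact mul_ne_zero ((map_ne_zero_iff _ PowerSeries.C_injective).mpr (pow_ne_zero m two_ne_zero)) h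

/-- An element of `Λ = ℤ₂⟦T⟧` with element-level `μ = m` and `λ = 0` is `C(2^m)` times a unit. [folklore] -/
theorem exists_unit_of_mu_of_lam {h : IwasawaAlgebra 2} (hh : h ≠ 0) {m : ℕ} (hμ : mu h = m)
    (hlam : lam h = 0) :
    ∃ u : (IwasawaAlgebra 2)ˣ, h = PowerSeries.C ((2 : ℤ_[2]) ^ m) * (u : IwasawaAlgebra 2) := by
  have hred := red_pfree_ne_zero hh
  have h0 : pfree h = PowerSeries.C (((2 : ℕ) : ℤ_[2]) ^ 0) * pfree h := by
    rw [pow_zero, map_one, one_mul]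
  obtain ⟨hμ0, hpf⟩ := mu_eq_and_pfree_eq hred h0
  have hlam0 : lam (pfree h) = 0 := by
    have : lam (pfree h) = lam h := by simp only [lam, hpf]
    rw [this, hlam]
  have hu : IsUnit (pfree h) :=
    (isUnit_iff_mu_eq_zero_and_lam_eq_zero _).mpr ⟨pfree_ne_zero hh, hμ0, hlam0⟩
  obtain ⟨u, hu'⟩ := hu
  refine ⟨u, ?_⟩
  conv_lhs => rw [eq_C_pow_mu_mul_pfree h]
  rw [hμ, hu']
  norm_cast

/-! ## §3. The bridge -/

/-- **CLASS-LEVEL BRIDGE at `p = 2`: Kobayashi's `+` main conjecture for `W` transported from a CM partner,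
from three displayed `p = 2` research binders.** Hypotheses `hmu2`, `hlam2` (B. D. Kim 2009 Cor. 2.13 read at
`2`), `hV2` (analytic congruence at `2`), then the REPAIRED K1 binders; conclusion `KobayashiMainConjecture W 2 1`.
Chain (as in the odd-`p` road p473173): Kato gives `char X⁺_W = (g)`, `ι(g·h) = 2^m ϖ ι L♭_W`; MC(A) gives
`char X⁺_A = (g_A)`, `ι g_A = ϖ_A ι L♭_A`; `μ(g) = μ(X⁺_W) = 0` (hmu2 + generator lemma), `μ(g_A) = 0`;
`λ(g) = λ(X⁺_W)`, `λ(g_A) = λ(X⁺_A)`; hlam2 and hV2 (at `G = g·h`, `G_A = g_A`, `m' = 0`) with additivity give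
`μ(h) = m`, `λ(h) = 0`, so `h = 2^m·u` and `g·u` is the Néron-normalised generator. Nothing asserted beyond
the binders. [cite: BDKim2009, Cor. 2.13, Cor. 2.5 and Prop. 2.6 (pp. 185–187)]
[cite: Kobayashi2003, Thm. 1.2 and Conjecture (p. 2)] [cite: GreenbergVatsal2000, p. 4 (after Thm. (1.2))] -/
theorem kobayashiMainConjecture_two_of_signedTransportBinders
    (hmu2 :
    ∀ (W : WeierstrassCurve ℚ) [W.IsElliptic] [W.IsGloballyMinimal] (A : WeierstrassCurve ℚ) [A.IsElliptic]
      [A.IsGloballyMinimal], GoodSS W 2 → W.frobeniusTrace 2 = 0 → GoodSS A 2 → A.frobeniusTrace 2 = 0 →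
    (∃ e : WeierstrassCurve.geomTorsion W (2 : ℤ) ≃+ WeierstrassCurve.geomTorsion A (2 : ℤ),
      ∀ (σ : Field.absoluteGaloisGroup ℚ) (P : WeierstrassCurve.geomTorsion W (2 : ℤ)), e (σ • P) = σ • e P) →
    ∀ (κ : ZpExtension ℚ 2) (γ : Field.absoluteGaloisGroup ℚ), κ.IsCyclotomic → κ.IsTopGenerator γ →
    ∀ (D : SignedSelmerDualData W κ γ 1) (D' : SignedSelmerDualData A κ γ 1)
      [Module.Finite (IwasawaAlgebra 2) D.X] [Module.Finite (IwasawaAlgebra 2) D'.X],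
      Module.IsTorsion (IwasawaAlgebra 2) D.X → Module.IsTorsion (IwasawaAlgebra 2) D'.X →
      D'.mu = 0 → D.mu = 0)
    (hlam2 :
    ∀ (W : WeierstrassCurve ℚ) [W.IsElliptic] [W.IsGloballyMinimal] (A : WeierstrassCurve ℚ) [A.IsElliptic]
      [A.IsGloballyMinimal], GoodSS W 2 → W.frobeniusTrace 2 = 0 → GoodSS A 2 → A.frobeniusTrace 2 = 0 →
    (∃ e : WeierstrassCurve.geomTorsion W (2 : ℤ) ≃+ WeierstrassCurve.geomTorsion A (2 : ℤ),
      ∀ (σ : Field.absoluteGaloisGroup ℚ) (P : WeierstrassCurve.geomTorsion W (2 : ℤ)), e (σ • P) = σ • e P) →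
    ∀ (κ : ZpExtension ℚ 2) (γ : Field.absoluteGaloisGroup ℚ), κ.IsCyclotomic → κ.IsTopGenerator γ →
    ∀ (S₀ : Finset (HeightOneSpectrum (𝓞 ℚ))), (∀ v ∈ S₀, ((2 : ℕ) : 𝓞 ℚ) ∉ v.asIdeal) →
      (∀ v : HeightOneSpectrum (𝓞 ℚ), ¬ W.HasGoodReductionAt v → v ∈ S₀) →
      (∀ v : HeightOneSpectrum (𝓞 ℚ), ¬ A.HasGoodReductionAt v → v ∈ S₀) →
    ∀ (D : SignedSelmerDualData W κ γ 1) (D' : SignedSelmerDualData A κ γ 1)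
      [Module.Finite (IwasawaAlgebra 2) D.X] [Module.Finite (IwasawaAlgebra 2) D'.X],
      Module.IsTorsion (IwasawaAlgebra 2) D.X → Module.IsTorsion (IwasawaAlgebra 2) D'.X → D.mu = 0 →
      lambdaInvariant 2 D.X + ∑ v ∈ S₀, delta W 2 v = lambdaInvariant 2 D'.X + ∑ v ∈ S₀, delta A 2 v)
    (hV2 :
    ∀ (W : WeierstrassCurve ℚ) [W.IsElliptic] [W.IsGloballyMinimal] (A : WeierstrassCurve ℚ) [A.IsElliptic]
      [A.IsGloballyMinimal], ¬ W.HasCM → W.analyticRank = 0 → GoodSS W 2 → W.frobeniusTrace 2 = 0 →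
      A.HasCM → GoodSS A 2 → A.frobeniusTrace 2 = 0 →
    (∃ e : WeierstrassCurve.geomTorsion W (2 : ℤ) ≃+ WeierstrassCurve.geomTorsion A (2 : ℤ),
      ∀ (σ : Field.absoluteGaloisGroup ℚ) (P : WeierstrassCurve.geomTorsion W (2 : ℤ)), e (σ • P) = σ • e P) →
    ∀ (γ : Field.absoluteGaloisGroup ℚ), IsCyclotomicVariable 2 γ →
    ∀ [NeZero (W.conductorNorm ℤ)] (f : CuspForm (Gamma0 (W.conductorNorm ℤ)) 2), IsNewformOf W f →
    ∀ (ϖ : ℚ), (ϖ : ℝ) * W.realPeriodRat = plusPeriod f →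
    ∀ (Lplus Lminus : IwasawaAlgebra 2), IsPollackPair f 2 Lplus Lminus →
    ∀ [NeZero (A.conductorNorm ℤ)] (fA : CuspForm (Gamma0 (A.conductorNorm ℤ)) 2), IsNewformOf A fA →
    ∀ (ϖA : ℚ), (ϖA : ℝ) * A.realPeriodRat = plusPeriod fA →
    ∀ (LplusA LminusA : IwasawaAlgebra 2), IsPollackPair fA 2 LplusA LminusA →
    ∀ (S₀ : Finset (HeightOneSpectrum (𝓞 ℚ))), (∀ v ∈ S₀, ((2 : ℕ) : 𝓞 ℚ) ∉ v.asIdeal) →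
      (∀ v : HeightOneSpectrum (𝓞 ℚ), ¬ W.HasGoodReductionAt v → v ∈ S₀) →
      (∀ v : HeightOneSpectrum (𝓞 ℚ), ¬ A.HasGoodReductionAt v → v ∈ S₀) →
    ∀ (G : IwasawaAlgebra 2) (m : ℕ), iwasawaToPowerSeries 2 G =
        PowerSeries.C ((2 : ℚ_[2]) ^ m * (ϖ : ℚ_[2])) * iwasawaToPowerSeries 2 (kobayashiL 1 Lplus Lminus) →
    ∀ (GA : IwasawaAlgebra 2) (m' : ℕ), iwasawaToPowerSeries 2 GA =
        PowerSeries.C ((2 : ℚ_[2]) ^ m' * (ϖA : ℚ_[2])) * iwasawaToPowerSeries 2 (kobayashiL 1 LplusA LminusA) →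
    mu G + m' = mu GA + m ∧ lam G + ∑ v ∈ S₀, delta W 2 v = lam GA + ∑ v ∈ S₀, delta A 2 v) :
  ∀ (W : WeierstrassCurve ℚ) [W.IsElliptic] [W.IsGloballyMinimal] (A : WeierstrassCurve ℚ) [A.IsElliptic]
    [A.IsGloballyMinimal], ¬ W.HasCM → W.analyticRank = 0 → GoodSS W 2 → W.frobeniusTrace 2 = 0 →
    A.HasCM → GoodSS A 2 → A.frobeniusTrace 2 = 0 →
    (∃ e : WeierstrassCurve.geomTorsion W (2 : ℤ) ≃+ WeierstrassCurve.geomTorsion A (2 : ℤ),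
      ∀ (σ : Field.absoluteGaloisGroup ℚ) (P : WeierstrassCurve.geomTorsion W (2 : ℤ)), e (σ • P) = σ • e P) →
    -- K2′ : the CM partner's signed duals are f.g., torsion, μ = 0
    (∀ (κ : ZpExtension ℚ 2) (γ : Field.absoluteGaloisGroup ℚ), κ.IsCyclotomic → κ.IsTopGenerator γ →
      ∀ D' : SignedSelmerDualData A κ γ 1, Module.Finite (IwasawaAlgebra 2) D'.X ∧
        Module.IsTorsion (IwasawaAlgebra 2) D'.X ∧ D'.mu = 0) →
    KobayashiMainConjecture A 2 1 →
    -- NEW: the partner's analytic data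
    ∀ [NeZero (A.conductorNorm ℤ)] (fA : CuspForm (Gamma0 (A.conductorNorm ℤ)) 2), IsNewformOf A fA →
    ∀ (ϖA : ℚ), (ϖA : ℝ) * A.realPeriodRat = plusPeriod fA →
    ∀ (LplusA LminusA : IwasawaAlgebra 2), IsPollackPair fA 2 LplusA LminusA →
    -- K4c′/K3′ : the signed duals of W are f.g. and torsion (Kobayashi 1.2 at 2)
    (∀ (κ : ZpExtension ℚ 2) (γ : Field.absoluteGaloisGroup ℚ), κ.IsCyclotomic → κ.IsTopGenerator γ →
      ∀ D : SignedSelmerDualData W κ γ 1, Module.Finite (IwasawaAlgebra 2) D.X ∧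
        Module.IsTorsion (IwasawaAlgebra 2) D.X) →
    -- K3 : Kato's divisibility for W through the `+` Coleman map at 2, up to 2^m (verbatim)
    (∀ (κ : ZpExtension ℚ 2) (γ : Field.absoluteGaloisGroup ℚ),
      κ.IsCyclotomic → κ.IsTopGenerator γ → IsCyclotomicVariable 2 γ →
      ∀ [NeZero (W.conductorNorm ℤ)] (f : CuspForm (Gamma0 (W.conductorNorm ℤ)) 2), IsNewformOf W f →
      ∀ (ϖ : ℚ), (ϖ : ℝ) * W.realPeriodRat = plusPeriod f →
      ∀ (Lplus Lminus : IwasawaAlgebra 2), IsPollackPair f 2 Lplus Lminus →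
      ∀ (D : SignedSelmerDualData W κ γ 1), ∃ (g h : IwasawaAlgebra 2) (m : ℕ),
        D.charIdeal = Ideal.span {g} ∧ iwasawaToPowerSeries 2 (g * h) =
          PowerSeries.C ((2 : ℚ_[2]) ^ m * (ϖ : ℚ_[2])) * iwasawaToPowerSeries 2 (kobayashiL 1 Lplus Lminus)) →
    KobayashiMainConjecture W 2 1 := by
  intro W _ _ A _ _ hcm hr hss ha hAcm hAss hAa hiso hA hMCA _ fA hfA ϖA hϖA LplusA LminusA hPPA hW12 hKato κ γ
    hκ hγ hcv _ f hf ϖ hϖ Lplus Lminus hPP D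
  -- Kobayashi 1.2 at 2 for W (binder)
  obtain ⟨hfinD, hX⟩ := hW12 κ γ hκ hγ D
  refine ⟨hX, ?_⟩
  -- Kato's divisibility for W (K3 shape)
  obtain ⟨g, h, m, hchar, hgh⟩ := hKato κ γ hκ hγ hcv f hf ϖ hϖ Lplus Lminus hPP D
  set ι := iwasawaToPowerSeries 2 with hι
  set L := kobayashiL (1 : ℤˣ) Lplus Lminus with hLdef
  have hL0 : PowerSeries.C (ϖ : ℚ_[2]) * ι L ≠ 0 := C_mul_iota_ne_zero hf hϖ hPP
  have hgh0 : g * h ≠ 0 := by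
    intro h0
    apply C_pow_mul_ne_zero m hL0
    rw [← hgh, h0, map_zero]
  have hg0 : g ≠ 0 := left_ne_zero_of_mul hgh0
  have hh0 : h ≠ 0 := right_ne_zero_of_mul hgh0
  -- the partner's datum, its structure (K2′) and its main conjecture at the supplied analytic data
  obtain ⟨DA⟩ := nonempty_signedSelmerDualData A κ (1 : ℤˣ) hγ
  obtain ⟨hfinA, hXA, hμA⟩ := hA κ γ hκ hγ DA
  obtain ⟨-, gA, hcharA, hιA⟩ := hMCA κ γ hκ hγ hcv fA hfA ϖA hϖA LplusA LminusA hPPA DA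
  have hgA0 : gA ≠ 0 := by
    intro h0
    apply C_mul_iota_ne_zero hfA hϖA hPPA
    rw [← hιA, h0, map_zero]
  -- an admissible S₀ (PROVED)
  obtain ⟨S₀, hS₀2, hS₀W, hS₀A⟩ := exists_admissiblePlaces W A hss.1 hAss.1
  -- Kμ2: μ(X⁺_W) = 0
  have hμD : D.mu = 0 := hmu2 W A hss ha hAss hAa hiso κ γ hκ hγ D DA hX hXA hμA
  -- Kλ2: λ(X⁺_W) + Σδ_W = λ(X⁺_A) + Σδ_A
  have hlamD := hlam2 W A hss ha hAss hAa hiso κ γ hκ hγ S₀ hS₀2 hS₀W hS₀A D DA hX hXA hμD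
  -- V2 at (G, m) := (g·h, m) and (G_A, m') := (g_A, 0)
  have hιA' : ι gA = PowerSeries.C ((2 : ℚ_[2]) ^ 0 * (ϖA : ℚ_[2])) * ι (kobayashiL 1 LplusA LminusA) := by
    rw [pow_zero, one_mul]; exact hιA
  obtain ⟨hμan, hlaman⟩ := hV2 W A hcm hr hss ha hAcm hAss hAa hiso γ hcv f hf ϖ hϖ
    Lplus Lminus hPP fA hfA ϖA hϖA LplusA LminusA hPPA S₀ hS₀2 hS₀W hS₀A (g * h) m hgh gA 0 hιA'
  -- generator lemmas: element-level μ/λ of g, g_A are the module invariants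
  have hμg : mu g = 0 := by
    rw [Summit.BirchSwinnertonDyer.Rank1Residual.X1.MuPart.mu_generator_eq_muInvariant D.X hX hg0 hchar]
    exact hμD
  have hμgA : mu gA = 0 := by
    rw [Summit.BirchSwinnertonDyer.Rank1Residual.X1.MuPart.mu_generator_eq_muInvariant DA.X hXA hgA0 hcharA]
    exact hμA
  have hlamg : lam g = lambdaInvariant 2 D.X :=
    Summit.BirchSwinnertonDyer.Rank1Residual.X1.ParitySqueeze.lam_generator_eq_lambdaInvariant D.X hX hg0 hchar
  have hlamgA : lam gA = lambdaInvariant 2 DA.X :=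
    Summit.BirchSwinnertonDyer.Rank1Residual.X1.ParitySqueeze.lam_generator_eq_lambdaInvariant DA.X hXA hgA0
      hcharA
  -- bookkeeping: μ(h) = m, λ(h) = 0
  rw [mu_mul hg0 hh0, hμg, hμgA] at hμan
  rw [lam_mul hg0 hh0, hlamg, hlamgA] at hlaman
  have hμh : mu h = m := by omega
  have hlamh : lam h = 0 := by omega
  -- h = 2^m · unit, and (g·u) is the Néron-normalised generator
  obtain ⟨u, hu⟩ := exists_unit_of_mu_of_lam hh0 hμh hlamh
  have h2m : (PowerSeries.C ((2 : ℚ_[2]) ^ m) : PowerSeries ℚ_[2]) ≠ 0 :=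
    (map_ne_zero_iff _ PowerSeries.C_injective).mpr (pow_ne_zero m two_ne_zero)
  have hιh : ι h = PowerSeries.C ((2 : ℚ_[2]) ^ m) * ι (u : IwasawaAlgebra 2) := by
    rw [hu, map_mul, hι, PowerSeries.map_C, map_pow, map_ofNat]
  refine ⟨g * u, ?_, ?_⟩
  · rw [hchar]; exact (Ideal.span_singleton_mul_right_unit u.isUnit g).symm
  · have key : PowerSeries.C ((2 : ℚ_[2]) ^ m) * ι (g * u) =
        PowerSeries.C ((2 : ℚ_[2]) ^ m) * (PowerSeries.C (ϖ : ℚ_[2]) * ι L) := by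
      calc PowerSeries.C ((2 : ℚ_[2]) ^ m) * ι (g * ↑u)
          = ι g * (PowerSeries.C ((2 : ℚ_[2]) ^ m) * ι ↑u) := by rw [map_mul]; ring
        _ = ι (g * h) := by rw [map_mul, hιh]
        _ = PowerSeries.C ((2 : ℚ_[2]) ^ m * (ϖ : ℚ_[2])) * ι L := hgh
        _ = PowerSeries.C ((2 : ℚ_[2]) ^ m) * (PowerSeries.C (ϖ : ℚ_[2]) * ι L) := by
          rw [map_mul, mul_assoc]
    exact mul_left_cancel₀ h2m key

end Summit.BirchSwinnertonDyer.BirchSwinnertonDyer.Theorems.SignedTransportAtTwo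

end
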